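import Summits.BirchSwinnertonDyer.BirchSwinnertonDyer.Theorems.SemiOrdinaryEisensteinDescentWildSplitEisensteinValueAtOneVIndexCurrency
import Summits.BirchSwinnertonDyer.BirchSwinnertonDyer.Theorems.SchneiderFreeAdditiveX3PoitouTateSelmerDualityHolds
import Summits.BirchSwinnertonDyer.BirchSwinnertonDyer.Theorems.ThetaPartnerAtTwoSignedControlAtTwoStubPoitouTateShaRat
import HarnessLib

/-!
# Crux E_𝟙^V `WildSplitEisensteinValueAtOneV` (stmt-BirchSwinnertonDyer-26610), line `index` — SKELETON v3
# (PT1 AND PT2 DISCHARGED BY NAME; 2 stubs: the research stub I_FH and the print binder PUB)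

Route `SemiOrdinaryEisensteinDescent` (SOED), crux #2″ of record since act G′-V (revs 20–25). v1 (sha16 92a01debefa51d83, staged by
width seat bsd-wall-soed-p1-w2 g12, registered by bsd-wall-soed-p1-w3 g15 09:20Z) had FOUR stubs; v2 (bsd-wall-soed-p1-w3 g17,
2026-08-28, registered 3e0c9c79) dropped `stub_poitouTateConj`: Poitou–Tate duality for Selmer structures is a THEOREM of the tree for
every number field — `SchneiderFreeAdditiveX3.PoitouTateReduction.poitouTate_selmerStructure_duality_holds` (cell bsd-schneider,
p624636; items 20461 / 23092 CLOSED·proved 10:38Z / 11:34Z by the INPUTS desk); v3 (same seat) also drops `stub_poitouTateSha`: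
PT2 `poitouTate_sha_tateDual K` (Milne ADT I Thm. 4.10 (a)) is a THEOREM of the tree for every number field since 11:36Z —
`SignedEC.PoitouTateShaRat.poitouTate_sha_tateDual_numberField` (cells bsd-schneider door-c4/door-c5 + bsd-inputs k4-p1: the
Ш²-readout road, bridge (nat, R4=) + (A) at real places). The composition consumes both by name.

IDEA (soed-p1-w3 g8 06:02:49Z datum, made kernel-exact by p614377): modulo print, `E_𝟙^V ⟺ I_FH` — the Gross–Zagier–BSD₃
lower bound on `#Ш(E/K)` at Friedberg–Hoffstein data, `2·ord₃[E(K):ℤP] ≤ ord₃#Ш(E/K) + 2·ord₃∏c_q + 2·ord₃c`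
(`SchneiderFree.IndexLowerBoundLeAt W 3 K P (v₃ c)`), with NO Iwasawa theory in the statement. So the line has ONE research stub
in index currency and ONE print stub by name; composition = p614377 §2
(`WildSplitEisensteinValueAtOneVIndexCurrency.valueAtOneV_of_indexLowerBoundFH_of_poitouTate`, sorry-free).

  crux ⟸ stub_indexLowerBoundFH   (I_FH — THE research stub: STEP L♯ at FH data on the O6 onto r₁ cell; walls W1–W3 of
                                    `Cruxes/WildSplitEisensteinInclusionAtThree/Lines/birth-dead*.md` concern Eisenstein-congruence
                                    ENGINES for it; index-currency engines (Kolyvagin primitivity M_∞ ≤ v₃(c∏c_q), visibility,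
                                    p-adic-BSD-free arguments) are not excluded by them; per-pair roads landed: p621234 / p623400
                                    (Kolyvagin–McCallum certificate), p628328 (Kriz–Li congruence transport), p626684 (L-idle data))
       + stub_publishedInputs       (PUB 20389 by name — print; only its Kolyvagin conjunct is consumed)
       [PT1 — DISCHARGED: `…SchneiderFreeAdditiveX3.PoitouTateReduction.poitouTate_selmerStructure_duality_holds`]
       [PT2 — DISCHARGED: `…SignedEC.PoitouTateShaRat.poitouTate_sha_tateDual_numberField`]

Hardest stub: stub_indexLowerBoundFH (XL, research). BSD is not proved by any of this.
-/

set_option autoImplicit false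
set_option linter.dupNamespace false

noncomputable section

open scoped Classical

namespace Summit.BirchSwinnertonDyer.BirchSwinnertonDyer.Theorems.SemiOrdinaryEisensteinDescentWildSplitEisensteinValueAtOneV

open Summit.BirchSwinnertonDyer.BirchSwinnertonDyer.Theses.SemiOrdinaryEisensteinDescent
  Summit.BirchSwinnertonDyer.BirchSwinnertonDyer.Theorems

/-- **Stub `stub_indexLowerBoundFH`** (THE research stub, index currency): at every Heegner datum of the O6 / ρ̄₃-onto / r_an = 1
cell with `L(E^(d_K),1) ≠ 0`, `P = y_K` non-torsion and `d_K` odd, `2·ord₃[E(K):ℤP] ≤ ord₃#Ш(E/K) + 2·ord₃∏c_q + 2·ord₃c`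
(JSW17 (eq:shalowerK-1) with the Manin slack; = «≥ half of the 3-part of #Ш(E/K)» in Gross–Zagier currency). Not in print at an
additive potentially supersingular 3 (JSW17 §7.4.1 / Castella–Wan need p ≥ 5 or semistable p). -/
theorem stub_indexLowerBoundFH :
    ∀ (W : WeierstrassCurve ℚ) [W.IsElliptic] [W.IsGloballyMinimal] (N : ℕ) [NeZero N] (K : Type) [Field K] [NumberField K] (Dt : Literature.NumberTheory.EllipticCurves.ModularForms.ModularParametrizationData W N) (H : Literature.NumberTheory.EllipticCurves.HeegnerDatum N (NumberField.discr K)) (ι : K →+* ℂ) (P : (W.baseChange K).toAffine.Point), Summit.BirchSwinnertonDyer.Rank1Residual.Additive.ClassO6 W 3 → W.HasSurjectiveModNGaloisRep 3 → W.analyticRank = 1 → W.conductorNorm ℤ = N → Literature.NumberTheory.EllipticCurves.IsImaginaryQuadratic K → Literature.NumberTheory.EllipticCurves.SatisfiesHeegnerHypothesis N K → (W.quadraticTwist (NumberField.discr K : ℚ)).entireLFunction 1 ≠ 0 → (WeierstrassCurve.Affine.Point.map ι.toRatAlgHom) P = Literature.NumberTheory.EllipticCurves.ModularForms.heegnerPointComplex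 Dt H → ¬ IsOfFinAddOrder P → Odd (NumberField.discr K) → Summit.BirchSwinnertonDyer.BirchSwinnertonDyer.Theorems.SchneiderFree.IndexLowerBoundLeAt W 3 K P (padicValNat 3 Dt.c.natAbs) := by
  sorry

/-- **Stub `stub_publishedInputs`**: the route's print package `PublishedInputsWildThree` (item 20389, split into six by-name leaves,
glue 20497 ✓) BY NAME. -/
theorem stub_publishedInputs : PublishedInputsWildThree := by
  sorry

/-- **Composition** (sorry-free): the crux `WildSplitEisensteinValueAtOneV` BY NAME from the two registered stubs and the tree
theorems PT1 (`poitouTate_selmerStructure_duality_holds`, p624636) and PT2 (`poitouTate_sha_tateDual_numberField`) — p614377 §2. -/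
theorem WildSplitEisensteinValueAtOneV_of : WildSplitEisensteinValueAtOneV :=
  WildSplitEisensteinValueAtOneVIndexCurrency.valueAtOneV_of_indexLowerBoundFH_of_poitouTate stub_publishedInputs
    stub_indexLowerBoundFH
    (fun K _ _ ↦ SchneiderFreeAdditiveX3.PoitouTateReduction.poitouTate_selmerStructure_duality_holds K)
    SignedEC.PoitouTateShaRat.poitouTate_sha_tateDual_numberField

end Summit.BirchSwinnertonDyer.BirchSwinnertonDyer.Theorems.SemiOrdinaryEisensteinDescentWildSplitEisensteinValueAtOneV

end
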